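import Literature.Topology.PlaneTopology.JordanNesting
import HarnessLib

/-!
# The fill of a Jordan loop: weak nesting

Topic: Topology / PlaneTopology, sequel to `JordanNesting.lean` (nesting of Jordan loops with
*disjoint* curves). The **fill** of a Jordan loop `A` is the closed disc `range A ∪ inside A`
(`= closure (inside A)`). For comparisons of curves which may **touch** (separatrix polygons
sharing edges, compact leaves touching polygons) we record the weak nesting statements:

* `interior_fill`, `frontier_fill` (**proved**): the interior of the fill is the inside, its
  frontier is the curve;
* `outside_subset_outside_of_range_subset_fill`, `inside_subset_fill_of_range_subset_fill`,
  `fill_subset_fill_of_range_subset_fill` (**proved**): a loop `C` (no hypothesis on `C`) running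
  in the fill of the Jordan loop `A` has its inside, hence its fill, in the fill of `A` (the
  outside of `A` is connected, unbounded and misses `C`);
* `range_eq_of_fill_eq` (**proved**): Jordan loops with the same fill have the same curve.

All statements are [folklore].
-/

noncomputable section

open Set Metric Bornology
open _root_.Topology

namespace Literature.Topology.PlaneTopology

namespace IsJordanLoop

variable {A C : ℝ → ℂ}

/-- **The fill** of a loop: the curve and its inside. [folklore] -/
def fill (A : ℝ → ℂ) : Set ℂ := range A ∪ inside A

/-- The fill of a Jordan loop is the closure of its inside. [folklore] -/
theorem fill_eq_closure_inside (hA : IsJordanLoop A) : fill A = closure (inside A) := by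
  rw [fill, hA.closure_inside_eq, union_comm]

/-- The complement of the fill is the outside. [folklore] -/
theorem compl_fill (A : ℝ → ℂ) : (fill A)ᶜ = outside A := by
  ext z
  simp only [fill, mem_compl_iff, mem_union, not_or]
  constructor
  · rintro ⟨h1, h2⟩; exact (mem_outside_iff_not_mem_inside h1).2 h2
  · intro h; exact ⟨outside_subset_compl_range h, fun h' ↦ disjoint_left.1 disjoint_inside_outside h' h⟩

/-- The fill of a Jordan loop is compact. [folklore] -/
theorem isCompact_fill (hA : IsJordanLoop A) : IsCompact (fill A) := by
  rw [hA.fill_eq_closure_inside]; exact hA.isCompact_closure_inside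

/-- The fill of a Jordan loop is closed. [folklore] -/
theorem isClosed_fill (hA : IsJordanLoop A) : IsClosed (fill A) := hA.isCompact_fill.isClosed

/-- **The interior of the fill is the inside.** [folklore] -/
theorem interior_fill (hA : IsJordanLoop A) : interior (fill A) = inside A := by
  apply Subset.antisymm
  · intro z hz
    -- a point of the curve is not interior: every neighbourhood meets the outside
    have hzfill : z ∈ fill A := interior_subset hz
    rcases hzfill with hzr | hzi
    · exfalso
      have hcl : z ∈ closure (outside A) := hA.range_subset_closure_outside hzr
      rw [mem_closure_iff_nhds] at hcl
      obtain ⟨w, hw, hwo⟩ := hcl _ (mem_interior_iff_mem_nhds.1 hz)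
      rw [← compl_fill] at hwo
      exact hwo hw
    · exact hzi
  · exact interior_maximal subset_union_right hA.isOpen_inside

/-- **The frontier of the fill is the curve.** [folklore] -/
theorem frontier_fill (hA : IsJordanLoop A) : frontier (fill A) = range A := by
  rw [frontier, hA.isClosed_fill.closure_eq, hA.interior_fill, fill, union_sdiff_right, sdiff_eq_left.2]
  exact disjoint_left.2 fun z hzr hzi ↦ hzi.1 hzr

/-- **A loop running in the fill of a Jordan loop has the outside of the latter outside it.**
[folklore] -/
theorem outside_subset_outside_of_range_subset_fill (hA : IsJordanLoop A) (h : range C ⊆ fill A) : outside A ⊆ outside C := by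
  refine subset_outside_of_isPreconnected hA.isPreconnected_outside (fun z hz hzC ↦ ?_) hA.not_isBounded_outside
  rw [← compl_fill] at hz
  exact hz (h hzC)

/-- **A loop running in the fill of a Jordan loop has its inside in that fill.** [folklore] -/
theorem inside_subset_fill_of_range_subset_fill (hA : IsJordanLoop A) (h : range C ⊆ fill A) : inside C ⊆ fill A := by
  intro z hz
  by_contra hzf
  have hzo : z ∈ outside A := by rw [← compl_fill]; exact hzf
  exact disjoint_left.1 disjoint_inside_outside hz (hA.outside_subset_outside_of_range_subset_fill h hzo)

/-- **A loop running in the fill of a Jordan loop has its fill in that fill.** [folklore] -/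
theorem fill_subset_fill_of_range_subset_fill (hA : IsJordanLoop A) (h : range C ⊆ fill A) : fill C ⊆ fill A :=
  union_subset h (hA.inside_subset_fill_of_range_subset_fill h)

/-- **Jordan loops with the same fill have the same curve.** [folklore] -/
theorem range_eq_of_fill_eq (hA : IsJordanLoop A) (hC : IsJordanLoop C) (h : fill C = fill A) : range C = range A := by
  rw [← hC.frontier_fill, ← hA.frontier_fill, h]

/-- A loop running in the fill of a Jordan loop, whose fill contains that fill, has the same
curve. [folklore] -/
theorem range_eq_of_range_subset_fill_of_fill_subset (hA : IsJordanLoop A) (hC : IsJordanLoop C) (h : range C ⊆ fill A)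
    (h' : fill A ⊆ fill C) : range C = range A :=
  hA.range_eq_of_fill_eq hC ((hA.fill_subset_fill_of_range_subset_fill h).antisymm h')

end IsJordanLoop

end Literature.Topology.PlaneTopology
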